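import Summits.CriticalPhenomena.CardyFormulaZ2.Theses.CardyMagicRigidity
import Literature.Probability.RandomPlanarGeometry.NestingTransform
import Literature.Probability.Percolation.FullPlaneCNL
import Mathlib

/-!
# Sketch — crux-ideate `stmt-CriticalPhenomena-4835` (`NestingRigidity`), round 1, ideator 1

First lemmas of the three crux idea cards

* `positive-cone-weight-doubling`  (§1),
* `markov-cascade-one-generation`  (§2),
* `newton-screening-atoms`          (§3).

Nothing in this file is a route item; the crux decl is
`Summit.CriticalPhenomena.CardyFormulaZ2.Theses.CardyMagicRigidity.NestingRigidity` and is only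
referred to by name.  Statements marked `sorry` are the first checkable claims of the lines
(they must elaborate, not be proved here); the trigonometric / definitional ones are proved.
-/

noncomputable section

open MeasureTheory Set Filter
open scoped Topology BigOperators ENNReal Real

namespace Summit.CriticalPhenomena.CardyFormulaZ2.Cruxes.NestingRigidity.Ideas

open Literature.Probability.RandomPlanarGeometry Literature.Probability.Percolation
  Literature.Probability.LatticeModels
open Summit.CriticalPhenomena.CardyFormulaZ2.Theses.CardyMagicRigidity

/-! ### Common vocabulary (all over existing declarations) -/

/-- Critical bond percolation on `ℤ²` (`P_{1/2}`). -/
abbrev percZ2 : Measure (BondConfig (Site 2)) := bondPercolation (zdGraph 2) half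

/-- All interface loops (both DKKMO types) of the configuration drawn on `δℤ²`. -/
abbrev loopsZ2 (δ : ℝ) (cfg : BondConfig (Site 2)) : Set (UnbasedLoop ℂ) :=
  (bondLoopConfig δ 0 cfg).loops

/-- The lattice nesting transform `Λ_δ(f) = E_{1/2}[A_f(loops of δℤ²)]` (the functional of
`MagicFormulaZ2`, cf. `LoopConfig.nestingWeight_eq_finprod`). -/
def transformZ2 (δ : ℝ) (f : ℂ → ℝ) : ℝ := ∫ cfg, (bondLoopConfig δ 0 cfg).nestingWeight f ∂percZ2

/-- The Gaussian functional of the crux: `exp((3/4π²) ∬ log‖x−y‖ f(x) f(y))`. -/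
def gaussZ2 (f : ℂ → ℝ) : ℝ := Real.exp (3 / (4 * π ^ 2) * ∫ x, ∫ y, Real.log ‖x - y‖ * f x * f y)

/-- `MagicFormulaZ2` literally says `Λ_δ(f) → gaussZ2 f` for admissible `f` (definitional check). -/
example (h : MagicFormulaZ2) (f : ℂ → ℝ) (R C : ℝ) (hm : Measurable f) (hb : ∀ z, |f z| ≤ C)
    (hs : ∀ z, R < ‖z‖ → f z = 0) (h0 : ∫ z, f z = 0) :
    Tendsto (fun δ : ℝ ↦ transformZ2 δ f) (𝓝[>] 0) (𝓝 (gaussZ2 f)) :=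
  h f R C hm hb hs h0

/-- One-point nesting count: the number of interface loops of `δℤ²` surrounding the closed ball
`B̄(x, ε)` (non-zero winding number there) and contained in the open ball `B(x, R)`. -/
def nestCount (x : ℂ) (ε R δ : ℝ) (cfg : BondConfig (Site 2)) : ℕ :=
  Set.ncard {u ∈ loopsZ2 δ cfg | Metric.closedBall x ε ⊆ {z | u.wind z ≠ 0} ∧ u.range ⊆ Metric.ball x R}

/-- The SSW / CLE₆ nesting exponent as a function of the loop weight `w ∈ [0, 2]`
(`w = 2cos(πs)`, `Δ = (3/4)(s² − 1/9)`): `Δ₆(1) = 0`, `Δ₆(0) = 5/48` (one arm),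
`Δ₆(2) = −1/12`. -/
def deltaSix (w : ℝ) : ℝ := (3 / 4) * ((Real.arccos (w / 2) / π) ^ 2 - 1 / 9)

/-! ### §1  Card `positive-cone-weight-doubling` -/

/-- (1a) **Positivity inside the cone.** If the charge of a loop lies in `[−5π/6, π/6]` then its
twisted weight `2cos(θ + π/3)` is non-negative. -/
theorem nestingFactor_nonneg_of_phase_mem {f : ℂ → ℝ} {u : UnbasedLoop ℂ}
    (h₁ : -(5 * π / 6) ≤ u.nestingPhase f) (h₂ : u.nestingPhase f ≤ π / 6) :
    0 ≤ u.nestingFactor f := by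
  rw [UnbasedLoop.nestingFactor]
  refine mul_nonneg (by norm_num) (Real.cos_nonneg_of_mem_Icc ⟨?_, ?_⟩) <;> linarith

/-- (1b) **The cone condition on `f` puts every loop charge in `[−5π/6, π/6]`** (whence (1a) for
every loop of every configuration): if `f` is integrable with `∫ f⁺ ≤ π/6` and `∫ f⁻ ≤ 5π/6`. -/
theorem nestingPhase_mem_of_cone {f : ℂ → ℝ} (hf : Integrable f)
    (hpos : ∫ z, max (f z) 0 ≤ π / 6) (hneg : ∫ z, max (-f z) 0 ≤ 5 * π / 6) (u : UnbasedLoop ℂ) :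
    -(5 * π / 6) ≤ u.nestingPhase f ∧ u.nestingPhase f ≤ π / 6 := by
  sorry

/-- (1c) **Weight doubling.** The involution `λ ↦ −λ − 2π/3` fixes the loop weight (it maps the
cone `[−5π/6, π/6]` onto itself, fixing `−π/3` where the weight is `2`). -/
theorem weight_doubling (θ : ℝ) :
    2 * Real.cos ((-θ - 2 * π / 3) + π / 3) = 2 * Real.cos (θ + π / 3) := by
  rw [show (-θ - 2 * π / 3) + π / 3 = -(θ + π / 3) by ring, Real.cos_neg]

/-- (1c') … but NOT the Gaussian exponent: `(3/4π²)λ² ≠ (3/4π²)λ'²` unless `λ = −π/3`; the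
difference is linear in `λ`, `(3/4π²)(λ'² − λ²) = (λ + π/3)/π`. -/
theorem exponent_gap (θ : ℝ) :
    3 / (4 * π ^ 2) * ((-θ - 2 * π / 3) ^ 2 - θ ^ 2) = (θ + π / 3) / π := by
  have hπ : π ≠ 0 := Real.pi_ne_zero
  field_simp
  ring

/-- (1d) **First stub of the line (one-point spectrum of bond-ℤ²).** For every weight
`w ∈ [0, 2]`, the `w`-tilted one-point nesting count between scales `ε` and `1` scales like
`ε^{Δ₆(w)}` with constants uniform in `ε`, eventually in the mesh: the whole CLE₆ nesting
spectrum (at `w = 0`: the one-arm exponent `5/48`) for bond percolation on `ℤ²`. -/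
def OnePointSpectrumZ2 : Prop :=
  ∀ w ∈ Set.Icc (0 : ℝ) 2, ∃ C : ℝ, 1 ≤ C ∧ ∀ ε ∈ Set.Ioo (0 : ℝ) (1 / 2),
    ∀ᶠ δ in 𝓝[>] (0 : ℝ),
      C⁻¹ * ε ^ deltaSix w ≤ ∫ cfg, w ^ nestCount 0 ε 1 δ cfg ∂percZ2 ∧
        ∫ cfg, w ^ nestCount 0 ε 1 δ cfg ∂percZ2 ≤ C * ε ^ deltaSix w

/-- (1d) as an implication from the crux's first hypothesis alone (positive cone + RSW
quasi-multiplicativity + weight doubling). -/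
theorem onePointSpectrum_of_magicFormula : MagicFormulaZ2 → OnePointSpectrumZ2 := by
  sorry

/-! ### §2  Card `markov-cascade-one-generation` -/

/-- (2a) **The interface-loop event is a cylinder on the loop's own edges**: two configurations of
lattice edges that agree on the medial vertices (= primal edges) listed in `γ` have the same
interface loops through `γ`.  (`IsMedialTurn ω e₋ e e₊` reads `ω` only at `e`.) -/
theorem isInterfaceLoop_congr_of_agree {ω ω' : BondConfig (Site 2)}
    (hω : ω ⊆ (zdGraph 2).edgeSet) (hω' : ω' ⊆ (zdGraph 2).edgeSet)
    {γ : List MedialVertex} (h : ∀ e ∈ γ, (e ∈ ω ↔ e ∈ ω')) :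
    IsInterfaceLoop ω γ ↔ IsInterfaceLoop ω' γ := by
  sorry

/-- Primal edges strictly inside the medial circuit `γ` (non-zero winding number of the drawn
loop `loopCurve 1 0 γ` at the edge midpoint, and not on `γ`). -/
def insideEdges (γ : List MedialVertex) : Set MedialVertex :=
  {e | (loopCurve 1 0 γ).wind (medialPoint 1 e) ≠ 0 ∧ e ∉ γ}

/-- Primal edges strictly outside the medial circuit `γ`. -/
def outsideEdges (γ : List MedialVertex) : Set MedialVertex :=
  {e | (loopCurve 1 0 γ).wind (medialPoint 1 e) = 0 ∧ e ∉ γ}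

/-- (2b) **Exact domain-Markov property of Bernoulli interfaces** (conditional independence of
inside and outside given that `γ` is an interface loop): for every inside-cylinder event `A` and
outside-cylinder event `B`,
`P(A ∩ B ∩ I_γ) · P(I_γ) = P(A ∩ I_γ) · P(B ∩ I_γ)`. Product measure + (2a). -/
def InterfaceMarkov : Prop :=
  ∀ (γ : List MedialVertex) (A₀ B₀ : Set (Set MedialVertex)),
    MeasurableSet {ω : BondConfig (Site 2) | ω ∩ insideEdges γ ∈ A₀} →
    MeasurableSet {ω : BondConfig (Site 2) | ω ∩ outsideEdges γ ∈ B₀} →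
      percZ2 ({ω | ω ∩ insideEdges γ ∈ A₀} ∩ {ω | ω ∩ outsideEdges γ ∈ B₀} ∩ {ω | IsInterfaceLoop ω γ}) *
          percZ2 {ω | IsInterfaceLoop ω γ} =
        percZ2 ({ω | ω ∩ insideEdges γ ∈ A₀} ∩ {ω | IsInterfaceLoop ω γ}) *
          percZ2 ({ω | ω ∩ outsideEdges γ ∈ B₀} ∩ {ω | IsInterfaceLoop ω γ})

/-- The interface loops of `δℤ²` lying inside the medial circuit `γ` (interior contained in the
interior of the drawn loop `γ`; `γ` itself is harmlessly included, its factor being `1` when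
`∫ f = 0`). Loops outside `γ` or surrounding `γ` are excluded. -/
def insideLoops (δ : ℝ) (γ : List MedialVertex) (cfg : BondConfig (Site 2)) : Set (UnbasedLoop ℂ) :=
  {u ∈ loopsZ2 δ cfg | {z | u.wind z ≠ 0} ⊆ {z | (loopCurve δ 0 γ).wind z ≠ 0}}

/-- The **wired-domain transform** `M_γ(f)` of the line: the `I_γ`-conditional expectation of the
twisted weight of the loops inside `γ`. By (2a) the conditioning only pins the states of the
edges listed in `γ`, so this is the transform of Bernoulli percolation in the lattice domain
bounded by `γ` with the boundary colours of an interface ("wired/dual-wired"). -/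
def domainTransform (δ : ℝ) (γ : List MedialVertex) (f : ℂ → ℝ) : ℝ :=
  (∫ cfg in {ω | IsInterfaceLoop ω γ}, (∏ᶠ u ∈ insideLoops δ γ cfg, u.nestingFactor f) ∂percZ2) /
    (percZ2 {ω | IsInterfaceLoop ω γ}).toReal

/-- (2c) **One-generation factorisation (first stub of the line).** For `f` carried by the
interior of `γ` with `∫ f = 0`, every loop not inside `γ` has twisted weight `1` (interiors of
interface loops are nested or disjoint), and by (2b) the inside weight is conditionally
independent of every outside-cylinder event `B` given `I_γ`:
`E[A_f ; I_γ ∩ B] = M_γ(f) · P(I_γ ∩ B)`.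
Summing over `γ` with `B = {γ is the outermost interface loop around supp f inside B(0,R)}`
(an outside event) gives the disintegration `Λ_δ(f) = E[M_{ℓ̃_R}(f)] + (error on the no-loop
event, probability ≍ (r/R)^{5/48})` that the cascade argument iterates. -/
def OneGenerationFactorisation : Prop :=
  ∀ (δ : ℝ) (γ : List MedialVertex) (f : ℂ → ℝ) (B₀ : Set (Set MedialVertex)),
    0 < δ → (∀ z, f z ≠ 0 → (loopCurve δ 0 γ).wind z ≠ 0) → ∫ z, f z = 0 →
    MeasurableSet {ω : BondConfig (Site 2) | ω ∩ outsideEdges γ ∈ B₀} →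
      ∫ cfg in {ω | IsInterfaceLoop ω γ} ∩ {ω | ω ∩ outsideEdges γ ∈ B₀},
          (bondLoopConfig δ 0 cfg).nestingWeight f ∂percZ2 =
        domainTransform δ γ f *
          (percZ2 ({ω | IsInterfaceLoop ω γ} ∩ {ω | ω ∩ outsideEdges γ ∈ B₀})).toReal

/-- (2c) is a lattice theorem (no limit, no hypothesis of the crux): product measure, (2a), and
non-crossing of interface loops. -/
theorem oneGenerationFactorisation_holds : OneGenerationFactorisation := by
  sorry

/-! ### §3  Card `newton-screening-atoms` -/

/-- (3a) **Newton's theorem for a neutral radial charge (the atom is invisible outside).**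
If `f` is radial about `x`, integrable, supported in `B̄(x, r)` and `∫ f = 0`, its logarithmic
potential vanishes at every point outside `B̄(x, r)`.  (Mathlib:
`circleAverage_log_norm_sub_const_eq_log_radius_add_posLog` + polar coordinates.) -/
theorem logPotential_eq_zero_of_radial_neutral {g : ℝ → ℝ} {x w : ℂ} {r : ℝ} {f : ℂ → ℝ}
    (hf : ∀ z, f z = g ‖z - x‖) (hfi : Integrable f) (hsupp : ∀ z, r < ‖z - x‖ → f z = 0)
    (h0 : ∫ z, f z = 0) (hw : r < ‖w - x‖) :
    ∫ z, Real.log ‖z - w‖ * f z = 0 := by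
  sorry

/-- (3b) **Screening of the cross energy.** For such an atom `f` and ANY integrable `h` supported
off the open disc, the logarithmic cross energy vanishes, so the Gaussian functional of the crux
factorises: `gaussZ2 (f + h) = gaussZ2 f * gaussZ2 h`. -/
theorem logEnergy_cross_eq_zero {g : ℝ → ℝ} {x : ℂ} {r : ℝ} {f h : ℂ → ℝ}
    (hf : ∀ z, f z = g ‖z - x‖) (hfi : Integrable f) (hsupp : ∀ z, r < ‖z - x‖ → f z = 0)
    (h0 : ∫ z, f z = 0) (hh : Integrable h) (hhsupp : ∀ w, ‖w - x‖ ≤ r → h w = 0) :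
    ∫ z, ∫ w, Real.log ‖z - w‖ * f z * h w = 0 := by
  sorry

/-- (3c) **First stub of the line: exact screening factorisation on `ℤ²`.** Under the crux's first
hypothesis, the twisted nesting functional of a neutral radial atom is asymptotically uncorrelated
— exactly, at every separation, even for test functions surrounding the atom — with the twisted
functional of every admissible `h` supported off its disc:
`Λ_δ(f + h) − Λ_δ(f) Λ_δ(h) → 0`. -/
def ScreeningFactorisationZ2 : Prop :=
  ∀ (g : ℝ → ℝ) (x : ℂ) (r R C : ℝ) (f h : ℂ → ℝ), (∀ z, f z = g ‖z - x‖) →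
    Measurable f → Measurable h → (∀ z, |f z| ≤ C) → (∀ z, |h z| ≤ C) →
    (∀ z, r < ‖z - x‖ → f z = 0) → (∀ w, ‖w - x‖ ≤ r → h w = 0) → (∀ z, R < ‖z‖ → h z = 0) →
    ∫ z, f z = 0 → ∫ z, h z = 0 →
      Tendsto (fun δ : ℝ ↦ transformZ2 δ (f + h) - transformZ2 δ f * transformZ2 δ h)
        (𝓝[>] 0) (𝓝 0)

/-- (3c) from `MagicFormulaZ2` and (3b) (algebra of limits; provable now given (3b)). -/
theorem screeningFactorisation_of_magicFormula : MagicFormulaZ2 → ScreeningFactorisationZ2 := by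
  sorry

end Summit.CriticalPhenomena.CardyFormulaZ2.Cruxes.NestingRigidity.Ideas
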